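import Literature.NumberTheory.EllipticCurves.FormalGroupLubinTateDivisionPoints
import Literature.NumberTheory.GaloisRepresentations.LubinTateBaseChange
import Literature.NumberTheory.GaloisRepresentations.LubinTateTowerGenerator
import HarnessLib

/-!
# A Lubin–Tate model of `Ê` over `ℤ_p` read over the coefficient ring `𝒪_F` of a local field with `𝒪_F ≅ ℤ_p`
# (a place of degree one): `V̂ ⊗ 𝒪_F = F_{[π]}` in the tree's `LTCoeff` layer, and the division points `ω_{n+1}`
# of `πX + X^q` give torsion points of `E₁` of order exactly `p^{n+1}` (de Shalit II.1.10, II.4.4 (12) — proofs only)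

Topic `NumberTheory/EllipticCurves` (theorems only; no definition, no named fact, no instance).  Sequel of
`FormalGroupLubinTateDivisionPoints` (model-free) and of `OrdinaryFormalGroupLubinTate` / `X049FormalGroupLubinTateTwo`
(`V.formalGroupLaw = LubinTate.ltF hA hP` over `ℤ_p` for an ordinary `V`).  The cell's measure lane works over an abstract
non-archimedean local field `F` (`= K_v`) with the Lubin–Tate layer of `LubinTateTorsion` / `LubinTateCharacter(Limit)` /
`LubinTateTowerGenerator`: coefficient ring `LTCoeff F` (discrete copy of `𝒪[F]`), datum `isLTRing_LTCoeff hπ`, series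
`πX + X^q` (`isLTSeries_LTCoeff π`), points `maxNilIdeal F E` of finite `E ⊆ F̄`, division points `genPt`, coherent generator
`cohPt hπ n` of the Tate module.  At a place of DEGREE ONE (`e : 𝒪[F] ≃+* ℤ_p`, `#𝓀_F = p`; de Shalit II.1.1 «`𝒪_𝔭 = ℤ_p`»)
this file transports the `ℤ_p`-identification to that layer:

* §1 `isLTSeries_map_LTCoeff_of_degree_one` — `P ↦ P ⊗ 𝒪_F` is in `𝔉_π` over `(LTCoeff F, π, #𝓀_F)` when `e π = π_ℤ`;
  ★ `formalGroupLaw_map_eq_ltF_of_degree_one` — **`(V ⊗ 𝒪_F)^ = F_{P ⊗ 𝒪_F}`** in the lane's datum `isLTRing_LTCoeff hπ`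
  (tree `LubinTate.map_ltF`); `natCast_eq_mul_of_degree_one` / `isUnit_map_of_degree_one` — `p = ϖ'·π` in `LTCoeff F` with
  `ϖ'` a unit (from `p = ϖ·π_ℤ` in `ℤ_p`: height one).
* §2 for a finite `E ⊆ F̄` and `y ∈ 𝔪_E` a PRIMITIVE `π^{n+1}`-division point of `F_{πX+X^q}`:
  ★★ `addOrderOf_ptOfZ_hom_one_of_degree_one` — **`P([1]_{P,f} y) ∈ E₁(E)` has order exactly `p^{n+1}`**;
  `pow_nsmul_ptOfZ_hom_one_eq_zero_iff_of_degree_one`.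
* §3 the coherent generator: `ltSMul_pow_succ_inclPt_cohPt` (`[π^{n+1}] ω_{n+1} = 0`), `ltSMul_pow_inclPt_cohPt_ne_zero`
  (`[πⁿ] ω_{n+1} ≠ 0`) in any finite `E ⊇ K_π^{n+1}`, and ★★★ `addOrderOf_ptOfZ_hom_one_cohPt` — **the point
  `U_n := P([1]_{P,f} ω_{n+1}) ∈ E₁(E)` has order exactly `p^{n+1}`**: de Shalit's II.4.4 (12) «`ω_n = t(ξ(Λ(𝔭⁻ⁿ)u_n))`,
  `u_n` primitive of level `𝔭ⁿ`» for the tree's generator `(cohPt hπ n)` of the Tate module — ingredient (R2) of the CM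
  bridge (cell `bsd-print-cf2`, `B6-BRIDGE-II-VALUES-w4g13.md` §2 (c), §4).
* §4 `curveOver_map_map_intCast` — for an INTEGER equation `W/ℤ` the curve over `E` so obtained is `W ⊗ E` (so its torsion over
  `E ⊆ F̄` is the global curve's, cf. the tree's `exists_pointsMapOfEmb_eq_of_nsmul_eq_zero`).

Cell `bsd-print-cf2`, width seat `bsd-line-cf2c-w4` g14; no summit statement is proved; BSD is not proved by any of this.

## References
* [deShalit1987] E. de Shalit, *Iwasawa theory of elliptic curves with complex multiplication* (1987), II §1.1, §1.10,
  II §4.4 (11)–(12), (iv).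
* [LubinTate1965] J. Lubin, J. Tate, Ann. of Math. 81 (1965), §1 Thm. 1 and Cor.
* [CasselsFrohlichANT1967] J.-P. Serre, *Local class field theory* (Cassels–Fröhlich Ch. VI), §3.5 Prop. 1, §3.6 Prop. 6.
* [SilvermanAEC2009] J. H. Silverman, *The Arithmetic of Elliptic Curves*, 2nd ed. (2009), VII.2.2.
-/

noncomputable section

open scoped Classical
open PowerSeries

namespace Literature.NumberTheory.EllipticCurves

open ValuativeRel Literature.NumberTheory.GaloisRepresentations
  Literature.NumberTheory.GaloisRepresentations.IsNonarchimedeanLocalField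
  Literature.NumberTheory.GaloisRepresentations.LubinTate
open Literature.NumberTheory.EllipticCurves.FormalGroupChart _root_.WeierstrassCurve

variable {F : Type} [Field F] [ValuativeRel F] [TopologicalSpace F] [IsNonarchimedeanLocalField F]

attribute [local instance] ltNormUniformSpace ltNormIsUniformAddGroup rk1 nF nE fintypeResidueField

/-! ## §1 Transport of the `ℤ_p`-identification to `LTCoeff F` -/

section Transport

variable {p : ℕ} [Fact p.Prime] (e : 𝒪[F] ≃+* ℤ_[p]) (hq : residueFieldCard F = p)
  {π : 𝒪[F]} (hπ : (valuation F).IsUniformizer (π : F)) {πZ : ℤ_[p]} (he : e π = πZ)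
  (hA : IsLTRing πZ p) {P : PowerSeries ℤ_[p]} (hP : IsLTSeries πZ p P)

omit [TopologicalSpace F] [IsNonarchimedeanLocalField F] in
/-- The transport map `ℤ_p → 𝒪_F → LTCoeff F` sends `π_ℤ` to `π`. [cite: deShalit1987, II §1.1] -/
theorem comp_symm_apply_eq_of (he : e π = πZ) :
    ((LTCoeff.of F).toRingHom.comp e.symm.toRingHom) πZ = LTCoeff.of F π := by
  rw [RingHom.comp_apply, RingEquiv.toRingHom_eq_coe, RingEquiv.toRingHom_eq_coe, RingHom.coe_coe, RingHom.coe_coe,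
    ← he, e.symm_apply_apply]

include hP he hq in
/-- **`P ⊗ 𝒪_F ∈ 𝔉_π` over `(LTCoeff F, π, #𝓀_F)`** for `P ∈ 𝔉_{π_ℤ}` over `(ℤ_p, π_ℤ, p)`, `e π = π_ℤ`, `#𝓀_F = p`.
[cite: CasselsFrohlichANT1967, Ch. VI §3.5] [cite: deShalit1987, II §1.10] -/
theorem isLTSeries_map_LTCoeff_of_degree_one :
    IsLTSeries (LTCoeff.of F π) (residueFieldCard F) (P.map ((LTCoeff.of F).toRingHom.comp e.symm.toRingHom)) := by
  have h := hP.map ((LTCoeff.of F).toRingHom.comp e.symm.toRingHom)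
  rw [comp_symm_apply_eq_of e he] at h
  rw [hq]
  exact h

include he hq in
/-- ★ **`(V ⊗ 𝒪_F)^ = F_{P ⊗ 𝒪_F}` in the lane's Lubin–Tate datum**: a `ℤ_p`-identification `V̂ = F_P` (`hV`) read over
`LTCoeff F` along `e⁻¹ : ℤ_p ≅ 𝒪_F` is the identification of the formal group law of `V ⊗ 𝒪_F` with the Lubin–Tate law of
`P ⊗ 𝒪_F` for the datum `isLTRing_LTCoeff hπ` of `LubinTateTorsion` (`map_formalGroupLaw` + `LubinTate.map_ltF`).
[cite: deShalit1987, II §1.10 Lemma] [cite: LubinTate1965, §1 Thm. 1] -/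
theorem formalGroupLaw_map_eq_ltF_of_degree_one (V : WeierstrassCurve ℤ_[p]) (hV : V.formalGroupLaw = ltF hA hP) :
    (V.map ((LTCoeff.of F).toRingHom.comp e.symm.toRingHom)).formalGroupLaw =
      ltF (isLTRing_LTCoeff hπ) (isLTSeries_map_LTCoeff_of_degree_one e hq he hP) := by
  rw [← map_formalGroupLaw, hV]
  exact map_ltF _ hA hP _ _

omit [TopologicalSpace F] [IsNonarchimedeanLocalField F] in
include he in
/-- **`p = ϖ'·π` in `LTCoeff F`** with `ϖ' = (e⁻¹ ϖ)` when `p = ϖ·π_ℤ` in `ℤ_p` (height one: `p = π π̄`).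
[cite: deShalit1987, II §1.10] -/
theorem natCast_eq_mul_of_degree_one {ϖ : ℤ_[p]} (hp : (p : ℤ_[p]) = ϖ * πZ) :
    ((p : ℕ) : LTCoeff F) = ((LTCoeff.of F).toRingHom.comp e.symm.toRingHom) ϖ * LTCoeff.of F π := by
  rw [← comp_symm_apply_eq_of e he, ← map_mul, ← hp, map_natCast]

omit [TopologicalSpace F] [IsNonarchimedeanLocalField F] in
/-- The transported cofactor `ϖ'` is a unit. [cite: deShalit1987, II §1.10] -/
theorem isUnit_map_of_degree_one {ϖ : ℤ_[p]} (hϖ : IsUnit ϖ) :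
    IsUnit (((LTCoeff.of F).toRingHom.comp e.symm.toRingHom) ϖ) :=
  hϖ.map _

end Transport

/-! ## §2 Division points of `πX + X^q` in a finite `E ⊆ F̄` give torsion points of `E₁(E)` of the exact order -/

section Points

variable {p : ℕ} [Fact p.Prime] (e : 𝒪[F] ≃+* ℤ_[p]) (hq : residueFieldCard F = p)
  {π : 𝒪[F]} (hπ : (valuation F).IsUniformizer (π : F)) {πZ : ℤ_[p]} (he : e π = πZ)
  (hA : IsLTRing πZ p) {P : PowerSeries ℤ_[p]} (hP : IsLTSeries πZ p P)
  {V : WeierstrassCurve ℤ_[p]} (hV : V.formalGroupLaw = ltF hA hP) {ϖ : ℤ_[p]} (hp : (p : ℤ_[p]) = ϖ * πZ) (hϖ : IsUnit ϖ)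
  (E : IntermediateField F (AlgebraicClosure F)) [FiniteDimensional F E]
  [hEll : (curveOver E (V.map ((LTCoeff.of F).toRingHom.comp e.symm.toRingHom))).IsElliptic]

include hq he hV hp hϖ in
/-- **`pⁿ • P([1]_{P,f} y) = O ↔ [πⁿ]_f y = 0`** for `y ∈ 𝔪_E`, `f = πX + X^q` (`FormalGroupLubinTateDivisionPoints` §4 in the
lane's layer; `maxNilIdeal F E` is `ballNilIdeal E`). [cite: deShalit1987, II §4.4 (12)] [cite: SilvermanAEC2009, VII.2.2] -/
theorem pow_nsmul_ptOfZ_hom_one_eq_zero_iff_of_degree_one (n : ℕ) (y : (maxNilIdeal F E).toIdeal) :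
    p ^ n • ptOfZ E (V.map ((LTCoeff.of F).toRingHom.comp e.symm.toRingHom))
        (evalPt₁ (maxNilIdeal F E) (hom (isLTRing_LTCoeff hπ) (isLTSeries_map_LTCoeff_of_degree_one e hq he hP)
          (isLTSeries_LTCoeff π) 1) (constantCoeff_hom _ _ _ 1) y) = 0 ↔
      ltSMul (maxNilIdeal F E) (isLTRing_LTCoeff hπ) (isLTSeries_LTCoeff π) (LTCoeff.of F π ^ n) y = 0 :=
  pow_nsmul_ptOfZ_hom_one_eq_zero_iff (K := E) (isLTRing_LTCoeff hπ) (isLTSeries_map_LTCoeff_of_degree_one e hq he hP)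
    (isLTSeries_LTCoeff π) (formalGroupLaw_map_eq_ltF_of_degree_one e hq hπ he hA hP V hV)
    (natCast_eq_mul_of_degree_one e he hp) (isUnit_map_of_degree_one e hϖ) n y

include hq he hV hp hϖ in
/-- ★★ **A primitive `π^{n+1}`-division point `y ∈ 𝔪_E` of `F_{πX+X^q}` gives a point `P([1]_{P,f} y) ∈ E₁(E)` of order
EXACTLY `p^{n+1}`** (place of degree one, ordinary `V`: `p = ϖπ`, `ϖ` a unit). [cite: deShalit1987, II §4.4 (12), (iv)]
[cite: SilvermanAEC2009, VII.2.2] -/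
theorem addOrderOf_ptOfZ_hom_one_of_degree_one {n : ℕ} {y : (maxNilIdeal F E).toIdeal}
    (hy : ltSMul (maxNilIdeal F E) (isLTRing_LTCoeff hπ) (isLTSeries_LTCoeff π) (LTCoeff.of F π ^ (n + 1)) y = 0)
    (hy' : ltSMul (maxNilIdeal F E) (isLTRing_LTCoeff hπ) (isLTSeries_LTCoeff π) (LTCoeff.of F π ^ n) y ≠ 0) :
    addOrderOf (ptOfZ E (V.map ((LTCoeff.of F).toRingHom.comp e.symm.toRingHom))
        (evalPt₁ (maxNilIdeal F E) (hom (isLTRing_LTCoeff hπ) (isLTSeries_map_LTCoeff_of_degree_one e hq he hP)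
          (isLTSeries_LTCoeff π) 1) (constantCoeff_hom _ _ _ 1) y)) = p ^ (n + 1) :=
  addOrderOf_ptOfZ_hom_one (K := E) (isLTRing_LTCoeff hπ) (isLTSeries_map_LTCoeff_of_degree_one e hq he hP)
    (isLTSeries_LTCoeff π) (formalGroupLaw_map_eq_ltF_of_degree_one e hq hπ he hA hP V hV)
    (natCast_eq_mul_of_degree_one e he hp) (isUnit_map_of_degree_one e hϖ) hy hy'

end Points

/-! ## §3 The coherent generator `(ω_{n+1}) = (cohPt hπ n)`: primitive of level `n+1`, and the torsion points `U_n` -/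

section CohPt

variable {π : 𝒪[F]} (hπ : (valuation F).IsUniformizer (π : F))
  (E : IntermediateField F (AlgebraicClosure F)) [FiniteDimensional F E]

/-- **`[π^{n+1}] ω_{n+1} = 0`** in any finite `E ⊇ K_π^{n+1}` (`ω_{n+1} = [u_n]λ_{n+1}`, `[π^{n+1}]λ_{n+1} = 0`).
[cite: deShalit1987, Ch. I §2.2] [cite: CasselsFrohlichANT1967, Ch. VI §3.6] -/
theorem ltSMul_pow_succ_inclPt_cohPt (n : ℕ) (h : ltField π n ≤ E) :
    ltSMul (maxNilIdeal F E) (isLTRing_LTCoeff hπ) (isLTSeries_LTCoeff π) (LTCoeff.of F π ^ (n + 1))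
      (inclPt h (cohPt hπ n)) = 0 := by
  have h1 : ltAct hπ n (π ^ (n + 1)) (cohPt hπ n) = 0 := by
    rw [cohPt_eq, ltAct_comm, ← mul_one (π ^ (n + 1)), ltAct_pow_mul_genPt]
    exact ltSMul_zero _ _ _ _
  have h1' : ltSMul (maxNilIdeal F (ltField π n)) (isLTRing_LTCoeff hπ) (isLTSeries_LTCoeff π) (LTCoeff.of F π ^ (n + 1))
      (cohPt hπ n) = 0 := by
    rw [← map_pow]; exact h1
  apply Subtype.ext
  rw [← inclUnitBall_ltSMul h (hA := isLTRing_LTCoeff hπ) (LTCoeff.of F π ^ (n + 1)) (cohPt hπ n), h1',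
    ZeroMemClass.coe_zero, ZeroMemClass.coe_zero, map_zero]

/-- **`[πⁿ] ω_{n+1} ≠ 0`** in any finite `E ⊇ K_π^{n+1}` (`f^{(n)}(ω_{n+1}) ≠ 0`: `ω_{n+1}` is PRIMITIVE of level `n+1`).
[cite: deShalit1987, Ch. I §2.2] [cite: CasselsFrohlichANT1967, Ch. VI §3.6 Prop. 6] -/
theorem ltSMul_pow_inclPt_cohPt_ne_zero (n : ℕ) (h : ltField π n ≤ E) :
    ltSMul (maxNilIdeal F E) (isLTRing_LTCoeff hπ) (isLTSeries_LTCoeff π) (LTCoeff.of F π ^ n)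
      (inclPt h (cohPt hπ n)) ≠ 0 := by
  intro h0
  have h1 := congrArg (fun z : (maxNilIdeal F E).toIdeal => (((z : unitBall E) : E) : AlgebraicClosure F)) h0
  rw [coe_ltSMul_pow hπ, ZeroMemClass.coe_zero, ZeroMemClass.coe_zero] at h1
  apply aeval_cohPt_ltPolyIter_ne_zero hπ n
  have h2 : (((inclPt h (cohPt hπ n) : (maxNilIdeal F E).toIdeal) : unitBall E) : E) =
      IntermediateField.inclusion h (((cohPt hπ n : (maxNilIdeal F (ltField π n)).toIdeal) : unitBall (ltField π n)) :
        ltField π n) := rfl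
  rw [h2, Polynomial.aeval_algHom_apply] at h1
  have h3 : ((IntermediateField.inclusion h (Polynomial.aeval (((cohPt hπ n : (maxNilIdeal F (ltField π n)).toIdeal) :
      unitBall (ltField π n)) : ltField π n) ((ltPolyIter F π n).map (algebraMap 𝒪[F] F))) : E) : AlgebraicClosure F) =
      ((0 : E) : AlgebraicClosure F) := h1
  rw [ZeroMemClass.coe_zero] at h3
  have h4 : IntermediateField.inclusion h (Polynomial.aeval (((cohPt hπ n : (maxNilIdeal F (ltField π n)).toIdeal) :
      unitBall (ltField π n)) : ltField π n) ((ltPolyIter F π n).map (algebraMap 𝒪[F] F))) = 0 := by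
    exact_mod_cast h3
  exact (map_eq_zero_iff _ (IntermediateField.inclusion h).injective).mp h4

variable {p : ℕ} [Fact p.Prime] (e : 𝒪[F] ≃+* ℤ_[p]) (hq : residueFieldCard F = p) {πZ : ℤ_[p]} (he : e π = πZ)
  (hA : IsLTRing πZ p) {P : PowerSeries ℤ_[p]} (hP : IsLTSeries πZ p P)
  {V : WeierstrassCurve ℤ_[p]} (hV : V.formalGroupLaw = ltF hA hP) {ϖ : ℤ_[p]} (hp : (p : ℤ_[p]) = ϖ * πZ) (hϖ : IsUnit ϖ)
  [hEll : (curveOver E (V.map ((LTCoeff.of F).toRingHom.comp e.symm.toRingHom))).IsElliptic]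

include hq he hV hp hϖ in
/-- ★★★ **de Shalit II.4.4 (12) for the tree's generator of the Tate module**: at a place of degree one (`𝒪_F ≅ ℤ_p`,
`#𝓀_F = p`), for an ordinary `V/ℤ_p` with `V̂ = F_P`, `P ∈ 𝔉_{π}`, `p = ϖπ` (`ϖ` a unit), and `h = [1]_{P,f} : F_{πX+X^q} ≃ V̂`,
the formal point **`U_n := P(h(ω_{n+1})) ∈ E₁(E)` of the coherent division point `ω_{n+1} = cohPt hπ n` has order EXACTLY
`p^{n+1}`** in `E(E)` for every finite `E ⊇ K_π^{n+1}` — `ω_{n+1} = t(U_n)` with `U_n` «primitive of level `𝔭^{n+1}`».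
[cite: deShalit1987, II §4.4 (11)–(12), (iv)] [cite: SilvermanAEC2009, VII.2.2] -/
theorem addOrderOf_ptOfZ_hom_one_cohPt (n : ℕ) (h : ltField π n ≤ E) :
    addOrderOf (ptOfZ E (V.map ((LTCoeff.of F).toRingHom.comp e.symm.toRingHom))
        (evalPt₁ (maxNilIdeal F E) (hom (isLTRing_LTCoeff hπ) (isLTSeries_map_LTCoeff_of_degree_one e hq he hP)
          (isLTSeries_LTCoeff π) 1) (constantCoeff_hom _ _ _ 1) (inclPt h (cohPt hπ n)))) = p ^ (n + 1) :=
  addOrderOf_ptOfZ_hom_one_of_degree_one e hq hπ he hA hP hV hp hϖ E (ltSMul_pow_succ_inclPt_cohPt hπ E n h)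
    (ltSMul_pow_inclPt_cohPt_ne_zero hπ E n h)

include hq he hV hp hϖ in
/-- `p^{n+1} • U_n = O`. [cite: deShalit1987, II §4.4 (12)] -/
theorem pow_succ_nsmul_ptOfZ_hom_one_cohPt (n : ℕ) (h : ltField π n ≤ E) :
    p ^ (n + 1) • ptOfZ E (V.map ((LTCoeff.of F).toRingHom.comp e.symm.toRingHom))
        (evalPt₁ (maxNilIdeal F E) (hom (isLTRing_LTCoeff hπ) (isLTSeries_map_LTCoeff_of_degree_one e hq he hP)
          (isLTSeries_LTCoeff π) 1) (constantCoeff_hom _ _ _ 1) (inclPt h (cohPt hπ n))) = 0 :=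
  (pow_nsmul_ptOfZ_hom_one_eq_zero_iff_of_degree_one e hq hπ he hA hP hV hp hϖ E (n + 1) _).mpr
    (ltSMul_pow_succ_inclPt_cohPt hπ E n h)

include hq he hV hp hϖ in
/-- `pⁿ • U_n ≠ O`. [cite: deShalit1987, II §4.4 (iv)] -/
theorem pow_nsmul_ptOfZ_hom_one_cohPt_ne_zero (n : ℕ) (h : ltField π n ≤ E) :
    p ^ n • ptOfZ E (V.map ((LTCoeff.of F).toRingHom.comp e.symm.toRingHom))
        (evalPt₁ (maxNilIdeal F E) (hom (isLTRing_LTCoeff hπ) (isLTSeries_map_LTCoeff_of_degree_one e hq he hP)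
          (isLTSeries_LTCoeff π) 1) (constantCoeff_hom _ _ _ 1) (inclPt h (cohPt hπ n))) ≠ 0 :=
  fun h0 => ltSMul_pow_inclPt_cohPt_ne_zero hπ E n h
    ((pow_nsmul_ptOfZ_hom_one_eq_zero_iff_of_degree_one e hq hπ he hA hP hV hp hϖ E n _).mp h0)

end CohPt

/-! ## §4 Integer models: the curve over `E` is the integer equation read in `E` -/

section IntModel

variable {p : ℕ} [Fact p.Prime] (e : 𝒪[F] ≃+* ℤ_[p]) (E : IntermediateField F (AlgebraicClosure F)) [FiniteDimensional F E]

/-- **Integer models commute with the transport**: for `W/ℤ`, the curve over `E` attached to `(W ⊗ ℤ_p) ⊗_{e⁻¹} LTCoeff F` is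
`W ⊗ E` (all coefficient maps fix the integers) — e.g. `49a1 = [1, −1, 0, −2, −1]` stays `[1, −1, 0, −2, −1]` over `E·K_π^{m+1}`, so its
torsion points over `E ⊆ F̄` are those of the global curve read in `F̄` (for `exists_pointsMapOfEmb_eq_of_nsmul_eq_zero`).
[cite: SilvermanAEC2009, VII.1] [cite: deShalit1987, II §4.1–4.2] -/
theorem curveOver_map_map_intCast (W : WeierstrassCurve ℤ) :
    curveOver E ((W.map (Int.castRingHom ℤ_[p])).map ((LTCoeff.of F).toRingHom.comp e.symm.toRingHom)) =
      W.map (Int.castRingHom E) := by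
  have key : ∀ n : ℤ, cK E (((LTCoeff.of F).toRingHom.comp e.symm.toRingHom) (Int.castRingHom ℤ_[p] n)) = (n : E) := by
    intro n
    rw [eq_intCast, map_intCast, cK, map_intCast]
    rfl
  obtain ⟨h₁, h₂, h₃, h₄, h₆⟩ := curveOver_a (K := E) (W := (W.map (Int.castRingHom ℤ_[p])).map
    ((LTCoeff.of F).toRingHom.comp e.symm.toRingHom))
  ext
  · rw [h₁, map_a₁, map_a₁, key, map_a₁, eq_intCast]
  · rw [h₂, map_a₂, map_a₂, key, map_a₂, eq_intCast]
  · rw [h₃, map_a₃, map_a₃, key, map_a₃, eq_intCast]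
  · rw [h₄, map_a₄, map_a₄, key, map_a₄, eq_intCast]
  · rw [h₆, map_a₆, map_a₆, key, map_a₆, eq_intCast]

end IntModel

end Literature.NumberTheory.EllipticCurves

end
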